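import Summits.ABC.ABC.Theses.LopsidedSzpiroSplit

/-!
# Birth skeleton (BC3) — crux `LopsidedABC` (stmt-ABC-18360), route `LopsidedSzpiroSplit`

Route `route-ABC-LopsidedSzpiroSplit` (ABC/ABC; abc = lopsided abc ∧ sextic Szpiro for the Frey 2-isogeny
codomain, glue `closes` kernel-checked in the route file); crux decl
`Summit.ABC.ABC.Theses.LopsidedSzpiroSplit.LopsidedABC` (rank 2, deciding):

  `∀ ε > 0, ∃ K > 0, ∀ abc triples (a,b,c), min(a,b) ≤ c^(1-ε) → c < K · rad(abc)^(1+ε)`.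

## The line: the prime-count split of the archimedean coincidence (route header, TWO-LAYER PLAN)

A lopsided triple is an archimedean near-coincidence of the two LARGE members: with `M = max(a,b)`,
`m = min(a,b) ≤ c^(1-ε)` one has `0 < Λ := log c - log M = log(1 + m/M) ≤ 2·c^(-ε)` (for `c ≥ 2`), and
`Λ = Σ_{p ∣ c} v_p(c) log p - Σ_{q ∣ M} v_q(M) log q` is a linear form in `ω(c·M)` logarithms of primes
(`c`, `M` coprime).  The number of logarithms `ω(c·M) = #(c·max(a,b)).primeFactors` is the parameter that
governs every transcendence lower bound for `Λ` (Baker–Wüstholz / Matveev: `log|Λ| ≥ -C^(n+1)·(∏ log pᵢ)·log B`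
in `n` logarithms), so the crux is cut along it:

* `stub_fewPrimeCoincidence` (OPEN; uniform few-logarithm Pillai/abc): for EACH `k`, lopsided abc on the cell
  `ω(c·max(a,b)) ≤ k`, constant `K = K(k,ε)`.  Here the archimedean Baker bound alone already gives the
  certified QUASI-POLYNOMIAL wall `log c ≤ C(k,η)·(log rad)^k·log log c` (in-tree support item
  `NegOmegaAtlas.UnbalancedQuasiPolynomial`, stmt-ABC-10558, whose hypothesis is exactly the arch bound in the
  primes of `b·c`), `k ≤ 1` is empty/trivial and the interesting content starts at `k = 2`
  (`c = pⁿ`, `max = q^m`, `pⁿ - q^m = min ≤ c^(1-ε)`: a size-uniform Pillai statement; per fixed bases it is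
  Baker/Stroeker–Tijdeman, `min = 1` is Mihăilescu).  Polynomial in `rad` is open for every `k ≥ 2`.
* `stub_manyPrimeCoincidence` (OPEN; the load-bearing half): for SOME threshold `k₀`, lopsided abc on the
  cell `ω(c·max(a,b)) > k₀`.  This is where the `∏ log p` loss of log-forms is worst and where the only
  sub-Stewart–Yu input is Pasten's Shimura-curve valuation product (`∏ v_p ≪ rad^(8/3+ε)`, Pasten2024 Thm 2.5,
  giving `log c ≤ η⁻¹exp(κ√(log R·log₂R))` on the lopsided domain, Thm 1.4(1) =
  `Literature.Barriers.ABC.pasten2024_thm_1_4_1_holds_of`, the route's BC5 rung); it also contains the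
  extremal lopsided data (`a = 1`, `c = 3^(2^n)`: `ω → ∞`).

Why this cell structure and not another (route header): `ω(c·max(a,b))` is invariant under the power maps
`(Mʲ, cʲ - Mʲ, cʲ)` which move lopsided triples across every archimedean-share / `ω(abc)` / squarefree-`c`
cell, so neither cell is `LopsidedABC`-complete by a cheap transfer; and it is the engine's own parameter.

Assembly: `LopsidedABC_of_stubs : <stub₁-sig> → <stub₂-sig> → LopsidedABC` is a REAL proof (take `k₀` from
stub 2, `K₁ = K(k₀,ε)` from stub 1, `K₂` from stub 2, `K = max K₁ K₂`, case on `ω(c·max(a,b)) ≤ k₀`), and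
`LopsidedABC_of : LopsidedABC := LopsidedABC_of_stubs stub_fewPrimeCoincidence stub_manyPrimeCoincidence`
concludes the crux BY NAME.  `sorry` occurs ONLY in the two `stub_*` theorems.  Both stubs are implied by
the crux (restrictions: `stubs_of_crux`, sorry-free), hence by `ABC`; neither implies the crux or `ABC`
cheaply (BC3 probes below).

These are the two stubs already registered on stmt-ABC-18360 by the typing seat planner-type-2a0d0ec4e7-0
(`ledger skeleton check`, 2026-08-17T16:01Z; identical names and signatures); this file is their
publication as the crux workfile `Lines/birth.lean` (the typing unit could not `crux write`).

BC3 (planner folder `bc/*_probe.lean`, 2026-08-17): for each stub `S`, `example : S → LopsidedABC` and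
`example : S → ABC` by `first | exact? | simpa | simpa [defs] | aesop | (unfold defs; aesop)` FAIL, while the
control `LopsidedABC → LopsidedABC` closes by `exact?` — no stub is cheaply the crux or the summit.

Disproof used: no `Disproof.lean` exists for this crux (`ledger crux ls stmt-ABC-18360`, 2026-08-17).  Landed
Negative lemmas (refuter at birth, `Summits/ABC/ABC/Theorems/LopsidedABC/Negative/WithoutExponentEps.lean`):
`Summit.ABC.ABC.Theorems.LopsidedABC.Negative.lopsidedABC_false_without_exponent_eps` (the crux with `ε`
dropped from the EXPONENT is false), `lopsidedABC_exponent_one_false`, `abc_no_uniform_constant_one`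
(Granville–Tucker's `a = 1` family `(1, 2ⁿ-1, 2ⁿ)`, `n = φ(p²)`, in every lopsided cell).  Honoured: both stubs
keep the exponent `1 + ε` and an `ε`-dependent constant (`K(k,ε)`, `K(ε)`); choosing the GT prime
`p ≡ 1 (mod m)` (Dirichlet) makes `τ(n)`, hence `ω(2ⁿ-1) ≥ τ(n) - 2` (Bang–Zsigmondy: a primitive prime divisor
of `2^d - 1` for every divisor `d ≠ 1, 6` of `n`), exceed any `k₀`, so the witnesses populate the MANY-prime
cell at every threshold: `ε` is load-bearing in `stub_manyPrimeCoincidence` exactly as in the crux, and no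
stub is an instance these lemmas refute.  (Not imported here only because the
module is minutes old and not yet built on every farm node.)  Skeleton vet of the registered stubs:
`Cruxes/LopsidedABC/SKELVET.md` (refuter-skel-stmt-ABC-18360-vet-0, PASS on a verbatim replica).
Negatives index (ABC): BelyiSqueeze.DegBelyiLower, GlobalQuasiLogDerivative — unrelated.
-/

-- `Summit.<Summit>.<Problem>`: for the single-conjunct summit `ABC` the duplicate `ABC.ABC` is mandated.
set_option linter.dupNamespace false

namespace Summit.ABC.ABC.Cruxes.LopsidedABC.Birth

open Literature.NumberTheory.DiophantineGeometry
open Summit.ABC.ABC.Theses.LopsidedSzpiroSplit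

/-! ## The registered stubs -/

/-- **Stub 1 (OPEN; few-logarithm cell, uniform Pillai/abc).** For every `k` and every `ε > 0` there is
`K = K(k, ε) > 0` such that every abc triple with `ω(c·max(a,b)) ≤ k` and `min(a,b) ≤ c^(1-ε)` satisfies
`c < K·rad(abc)^(1+ε)`.  Why plausibly true: implied by abc; the archimedean linear form
`Λ = log c - log max(a,b)` has `≤ k` logarithms and `0 < Λ ≤ 2c^(-ε)`, so Baker–Wüstholz/Matveev give the
certified quasi-polynomial wall `log c ≪_{k,ε} (log rad)^k · log log c` (NegOmegaAtlas.UnbalancedQuasiPolynomial,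
stmt-ABC-10558); the stub asks for the polynomial upgrade, open from `k = 2` (size-uniform Pillai
`pⁿ - q^m = min`).  Why it might fail: only together with abc (it is a restriction of the crux).
Sources: BakerWustholz2007 §3.7, §7.2 (Matveev); EvertseGyory2015 §4.6; Pasten2024 §2; Mihailescu2004;
in-tree `Literature.Barriers.ABC.BakerMethodBounds`. -/
theorem stub_fewPrimeCoincidence :
    ∀ k : ℕ, ∀ ε : ℝ, 0 < ε → ∃ K : ℝ, 0 < K ∧ ∀ a b c : ℕ, IsABCTriple a b c →
      (c * max a b).primeFactors.card ≤ k → ((min a b : ℕ) : ℝ) ≤ (c : ℝ) ^ (1 - ε) →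
        (c : ℝ) < K * ((rad a b c : ℕ) : ℝ) ^ (1 + ε) := by
  sorry

/-- **Stub 2 (OPEN; many-logarithm cell, load-bearing).** There is a threshold `k₀` such that for every
`ε > 0` some `K > 0` works for all abc triples with `ω(c·max(a,b)) > k₀` and `min(a,b) ≤ c^(1-ε)`:
`c < K·rad(abc)^(1+ε)`.  Why plausibly true: implied by abc (any `k₀`); it is the cell where many primes
divide the two coincident members, so `rad(abc) ≥ ∏_{p ∣ c·max} p` grows at least like the `k₀`-th primorial
and the Shimura-curve valuation product `∏_{p∣abc} v_p(abc) ≪ rad^(8/3+ε)` (Pasten2024 Thm 2.5) is the one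
input beyond Stewart–Yu; best known on the whole lopsided domain: `log c ≤ η⁻¹·exp(κ√(log R·log₂R))`
(Pasten2024 Thm 1.4(1) = `Literature.Barriers.ABC.pasten2024_thm_1_4_1_holds_of`).  Why it might fail: only with
abc; as a USEFUL stub it fails if no `k₀` makes the many-prime cell easier than the crux (then the cut is
cosmetic and the line is re-drawn).  Sources: Pasten2024 (arXiv:2312.03566) Thm 1.4(1), Thm 2.5; StewartYu2001;
BakerWustholz2007 §3.7; in-tree `Literature.Barriers.ABC.BakerMethodBoundsPastenDecomposition`. -/
theorem stub_manyPrimeCoincidence :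
    ∃ k : ℕ, ∀ ε : ℝ, 0 < ε → ∃ K : ℝ, 0 < K ∧ ∀ a b c : ℕ, IsABCTriple a b c →
      k < (c * max a b).primeFactors.card → ((min a b : ℕ) : ℝ) ≤ (c : ℝ) ^ (1 - ε) →
        (c : ℝ) < K * ((rad a b c : ℕ) : ℝ) ^ (1 + ε) := by
  sorry

/-! ## Assembly (sorry-free) -/

/-- **ASSEMBLY (kernel-checked, no `sorry`).** The two stub statements imply the crux
`Summit.ABC.ABC.Theses.LopsidedSzpiroSplit.LopsidedABC` BY NAME: take the threshold `k₀` of the many-prime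
stub, the constants `K₁ = K(k₀, ε)` (few-prime stub) and `K₂` (many-prime stub), put `K := max K₁ K₂`, and
split each lopsided abc triple on `ω(c·max(a,b)) ≤ k₀` / `> k₀`. [folklore] -/
theorem LopsidedABC_of_stubs
    (hF : ∀ k : ℕ, ∀ ε : ℝ, 0 < ε → ∃ K : ℝ, 0 < K ∧ ∀ a b c : ℕ, IsABCTriple a b c →
      (c * max a b).primeFactors.card ≤ k → ((min a b : ℕ) : ℝ) ≤ (c : ℝ) ^ (1 - ε) →
        (c : ℝ) < K * ((rad a b c : ℕ) : ℝ) ^ (1 + ε))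
    (hM : ∃ k : ℕ, ∀ ε : ℝ, 0 < ε → ∃ K : ℝ, 0 < K ∧ ∀ a b c : ℕ, IsABCTriple a b c →
      k < (c * max a b).primeFactors.card → ((min a b : ℕ) : ℝ) ≤ (c : ℝ) ^ (1 - ε) →
        (c : ℝ) < K * ((rad a b c : ℕ) : ℝ) ^ (1 + ε)) :
    Summit.ABC.ABC.Theses.LopsidedSzpiroSplit.LopsidedABC := by
  obtain ⟨k₀, hk₀⟩ := hM
  intro ε hε
  obtain ⟨K₁, hK₁, h₁⟩ := hF k₀ ε hε
  obtain ⟨K₂, hK₂, h₂⟩ := hk₀ ε hε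
  refine ⟨max K₁ K₂, lt_max_of_lt_left hK₁, fun a b c habc hmin => ?_⟩
  have hR : (0 : ℝ) ≤ ((rad a b c : ℕ) : ℝ) ^ (1 + ε) := Real.rpow_nonneg (Nat.cast_nonneg _) _
  rcases le_or_gt (c * max a b).primeFactors.card k₀ with hle | hlt
  · exact (h₁ a b c habc hle hmin).trans_le (mul_le_mul_of_nonneg_right (le_max_left _ _) hR)
  · exact (h₂ a b c habc hlt hmin).trans_le (mul_le_mul_of_nonneg_right (le_max_right _ _) hR)

/-- **THE SKELETON THEOREM (registrar shape).** The crux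
`Summit.ABC.ABC.Theses.LopsidedSzpiroSplit.LopsidedABC`, concluded BY NAME from the two declared stubs through
the sorry-free assembly `LopsidedABC_of_stubs`; the only `sorry`s in its closure are
`stub_fewPrimeCoincidence` and `stub_manyPrimeCoincidence`. -/
theorem LopsidedABC_of : Summit.ABC.ABC.Theses.LopsidedSzpiroSplit.LopsidedABC :=
  LopsidedABC_of_stubs stub_fewPrimeCoincidence stub_manyPrimeCoincidence

/-! ## Exactness of the cut (sorry-free, informational) -/

/-- Both stub statements are restrictions of the crux (so the cut loses nothing and neither stub can be
refuted short of refuting `LopsidedABC`, hence `ABC`). [folklore] -/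
theorem stubs_of_crux (h : Summit.ABC.ABC.Theses.LopsidedSzpiroSplit.LopsidedABC) :
    (∀ k : ℕ, ∀ ε : ℝ, 0 < ε → ∃ K : ℝ, 0 < K ∧ ∀ a b c : ℕ, IsABCTriple a b c →
      (c * max a b).primeFactors.card ≤ k → ((min a b : ℕ) : ℝ) ≤ (c : ℝ) ^ (1 - ε) →
        (c : ℝ) < K * ((rad a b c : ℕ) : ℝ) ^ (1 + ε)) ∧
    (∃ k : ℕ, ∀ ε : ℝ, 0 < ε → ∃ K : ℝ, 0 < K ∧ ∀ a b c : ℕ, IsABCTriple a b c →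
      k < (c * max a b).primeFactors.card → ((min a b : ℕ) : ℝ) ≤ (c : ℝ) ^ (1 - ε) →
        (c : ℝ) < K * ((rad a b c : ℕ) : ℝ) ^ (1 + ε)) := by
  refine ⟨fun k ε hε => ?_, ⟨0, fun ε hε => ?_⟩⟩
  · obtain ⟨K, hK, hK'⟩ := h ε hε
    exact ⟨K, hK, fun a b c habc _ hmin => hK' a b c habc hmin⟩
  · obtain ⟨K, hK, hK'⟩ := h ε hε
    exact ⟨K, hK, fun a b c habc _ hmin => hK' a b c habc hmin⟩

end Summit.ABC.ABC.Cruxes.LopsidedABC.Birth
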